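import Literature.Computability.Complexity.TimeBoundsProofs
import Mathlib.Data.Fintype.Sigma
import Mathlib.Data.Set.Finite.Basic
import Mathlib.Data.Set.Finite.Lattice
import HarnessLib

/-!
# Window locality of one step of a `TM2` machine; halting runs as exact iterates

Toolkit over Mathlib's multi-stack machines `Turing.TM2` / `Turing.FinTM2` for tableau-style
simulations (circuits, `P ⊆ P/poly`, `BPP ⊆ BQP`): the locality of a Turing machine step
underlying tableau proofs — Sipser 2012, proof of Thm. 9.30 (`TIME(t) ⊆ SIZE(O(t²))`: the
gates of the circuit "compute the value at a cell from the values of the three cells that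
affect it"), Arora–Barak 2009, Thm. 6.6 (`P ⊆ P/poly`) with Remark 6.7 and Thm. 6.13
(`P`-uniformity) — transported to `TM2`, where one step executes a whole statement tree
`TM2.Stmt` that may push, peek and pop several stacks several times, so that "three cells"
becomes "the top `depth` symbols of every stack".

* `opDepth q`: the number of stack instructions on the worst execution path of `q`;
  `depth tm`: its maximum over the statements of a `FinTM2`.
* **Window lemma** `stepAux_append`: if every stack is split as `W k ++ R k` with the window
  `W k` at least `opDepth q` long (or the whole stack), then
  `stepAux q v (W ++ R) = ⟨l', v', W' ++ R⟩` where `⟨l', v', W'⟩ = stepAux q v W`. Machine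
  form: `stepTotal_window` (one step = the step on the top-`d` windows, remainders
  re-appended, for any `d ≥ depth tm`). Hence the new label, state and top segments are a
  function of finitely much data, and stack cell `j` moves by at most `d`.
* `stepTotal`: the total step function (identity when halted);
  `iterate_stepTotal_of_outputsWithin`: `M.OutputsWithin l l' T` implies
  `stepTotal^[T] (initList …) = haltList …` (a halted machine idles, so exactly `T` rows).
* Length bookkeeping: `length_stepAux_le'`, `length_le_length_stepAux`,
  `length_iterate_stepTotal_le` (`≤ |input| + depth · t`).
* Effective alphabets: `FinTM2` only requires the *input* stack alphabet to be finite;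
  `PushesSym q k γ` (inductive family: `γ` is in the range of a `push k` instruction of `q`),
  `IsSym tm k γ` (pushable, or `k` is the input stack), `finite_isSym`, and the invariant
  `Good` (all stack symbols are effective symbols): `good_initList`, `Good.stepTotal`,
  `Good.iterate`.

## References

* M. Sipser, *Introduction to the Theory of Computation*, 3rd ed. (2012), Thm. 9.30 and its
  proof (tableau of a `t(n)`-time machine; a halted machine keeps its configuration).
* S. Arora, B. Barak, *Computational Complexity: A Modern Approach*, CUP 2009, Thm. 6.6,
  Remark 6.7, Def. 6.12, Thm. 6.13 (`P`-uniform circuit families), §1.3.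
* Mathlib, `Mathlib/Computability/TuringMachine/StackTuringMachine.lean` (`TM2.stepAux`,
  `TM2.step`), `Mathlib/Computability/TuringMachine/Computable.lean` (`FinTM2`, `initList`,
  `haltList`, `TM2OutputsInTime`).
-/

namespace Literature.Computability.Complexity.TM2Sim

open Turing Function

/-! ### Stack-operation depth and the window lemma -/

section Stmt

variable {K : Type} [DecidableEq K] {Γ : K → Type} {Λ σ : Type}

/-- The maximal number of stack instructions (`push`, `peek`, `pop`) along an execution path
of a TM2 statement. One step of the machine reads and modifies each stack only within its
top `opDepth` symbols. [folklore] -/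
def opDepth : TM2.Stmt Γ Λ σ → ℕ
  | TM2.Stmt.push _ _ q => opDepth q + 1
  | TM2.Stmt.peek _ _ q => opDepth q + 1
  | TM2.Stmt.pop _ _ q => opDepth q + 1
  | TM2.Stmt.load _ q => opDepth q
  | TM2.Stmt.branch _ q₁ q₂ => max (opDepth q₁) (opDepth q₂)
  | TM2.Stmt.goto _ => 0
  | TM2.Stmt.halt => 0

/-- Head of a split stack: if the window is nonempty or is the whole stack, the top symbol is
the top of the window. [folklore] -/
theorem head?_append_of {α : Type} {W R : List α} (h : 1 ≤ W.length ∨ R = []) :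
    (W ++ R).head? = W.head? := by
  rcases W with _ | ⟨a, W⟩
  · rcases h with h | h
    · simp at h
    · simp [h]
  · rfl

/-- Tail of a split stack, under the same hypothesis. [folklore] -/
theorem tail_append_of {α : Type} {W R : List α} (h : 1 ≤ W.length ∨ R = []) :
    (W ++ R).tail = W.tail ++ R := by
  rcases W with _ | ⟨a, W⟩
  · rcases h with h | h
    · simp at h
    · simp [h]
  · rfl

/-- Updating one stack of a split stack assignment updates the window part. [folklore] -/
theorem update_append (W R : ∀ k, List (Γ k)) (k : K) (L : List (Γ k)) :
    update (fun j => W j ++ R j) k (L ++ R k) = fun j => update W k L j ++ R j := by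
  funext j
  by_cases hj : j = k
  · subst hj; simp
  · simp [update_of_ne hj]

/-- **Window lemma.** Split every stack as `W k ++ R k` (window on top, remainder below).
If each window is either at least `opDepth q` symbols long or is the whole stack, then
executing the statement `q` on the full stacks is executing it on the windows and
re-appending the remainders: the label, the internal state and the new windows are those of
the window computation. (The `TM2` form of "the value at a cell is computed from the values
of the cells that affect it", Sipser 2012, proof of Thm. 9.30; Arora–Barak 2009, proof of
Thm. 6.6.) [cite: Sipser2012, Thm. 9.30 (proof)] -/
theorem stepAux_append (q : TM2.Stmt Γ Λ σ) (v : σ) (W R : ∀ k, List (Γ k))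
    (h : ∀ k, opDepth q ≤ (W k).length ∨ R k = []) :
    TM2.stepAux q v (fun k => W k ++ R k) =
      ⟨(TM2.stepAux q v W).l, (TM2.stepAux q v W).var,
        fun k => (TM2.stepAux q v W).stk k ++ R k⟩ := by
  induction q generalizing v W with
  | push k f q ih =>
    simp only [TM2.stepAux]
    have hupd : update (fun j => W j ++ R j) k (f v :: (W k ++ R k)) =
        fun j => update W k (f v :: W k) j ++ R j := by
      rw [← List.cons_append]; exact update_append W R k _
    rw [hupd]
    refine ih v (update W k (f v :: W k)) fun j => ?_
    rcases h j with hj | hj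
    · left
      simp only [opDepth] at hj
      by_cases hjk : j = k
      · subst hjk; simp; omega
      · rw [update_of_ne hjk]; omega
    · exact Or.inr hj
  | peek k f q ih =>
    simp only [TM2.stepAux]
    have hk : 1 ≤ (W k).length ∨ R k = [] := by
      rcases h k with hk | hk
      · left; simp only [opDepth] at hk; omega
      · exact Or.inr hk
    rw [head?_append_of hk]
    refine ih _ W fun j => ?_
    rcases h j with hj | hj
    · left; simp only [opDepth] at hj; omega
    · exact Or.inr hj
  | pop k f q ih =>
    simp only [TM2.stepAux]
    have hk : 1 ≤ (W k).length ∨ R k = [] := by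
      rcases h k with hk | hk
      · left; simp only [opDepth] at hk; omega
      · exact Or.inr hk
    rw [head?_append_of hk, tail_append_of hk, update_append W R k _]
    refine ih _ (update W k (W k).tail) fun j => ?_
    rcases h j with hj | hj
    · left
      simp only [opDepth] at hj
      by_cases hjk : j = k
      · subst hjk; simp; omega
      · rw [update_of_ne hjk]; omega
    · exact Or.inr hj
  | load f q ih =>
    simp only [TM2.stepAux]
    exact ih _ W fun j => by
      rcases h j with hj | hj
      · left; simpa [opDepth] using hj
      · exact Or.inr hj
  | branch p q₁ q₂ ih₁ ih₂ =>
    simp only [TM2.stepAux]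
    cases p v
    · exact ih₂ v W fun j => by
        rcases h j with hj | hj
        · left; simp only [opDepth] at hj; exact le_of_max_le_right hj
        · exact Or.inr hj
    · exact ih₁ v W fun j => by
        rcases h j with hj | hj
        · left; simp only [opDepth] at hj; exact le_of_max_le_left hj
        · exact Or.inr hj
  | goto l => rfl
  | halt => rfl

/-- Executing a statement lengthens each stack by at most `opDepth` symbols. [folklore] -/
theorem length_stepAux_le' (q : TM2.Stmt Γ Λ σ) (v : σ) (S : ∀ k, List (Γ k)) (k : K) :
    ((TM2.stepAux q v S).stk k).length ≤ (S k).length + opDepth q := by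
  induction q generalizing v S with
  | push k' f q ih =>
    simp only [TM2.stepAux, opDepth]
    refine (ih _ _).trans ?_
    have := TM2Comp.length_update_cons_le S k' k (f v)
    omega
  | peek k' f q ih => simp only [TM2.stepAux, opDepth]; exact (ih _ _).trans (by omega)
  | pop k' f q ih =>
    simp only [TM2.stepAux, opDepth]
    refine (ih _ _).trans ?_
    have := TM2Comp.length_update_tail_le S k' k
    omega
  | load f q ih => simp only [TM2.stepAux, opDepth]; exact ih _ _
  | branch p q₁ q₂ ih₁ ih₂ =>
    simp only [TM2.stepAux, opDepth]
    cases p v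
    · exact (ih₂ _ _).trans (by have := le_max_right (opDepth q₁) (opDepth q₂); omega)
    · exact (ih₁ _ _).trans (by have := le_max_left (opDepth q₁) (opDepth q₂); omega)
  | goto l => simp [TM2.stepAux, opDepth]
  | halt => simp [TM2.stepAux, opDepth]

/-- Popping one symbol shortens any stack by at most one. [folklore] -/
theorem length_le_length_update_tail (S : ∀ k, List (Γ k)) (k' k : K) :
    (S k).length ≤ (update S k' (S k').tail k).length + 1 := by
  rcases eq_or_ne k k' with rfl | h
  · simp; omega
  · rw [update_of_ne h]; exact Nat.le_succ _

/-- Executing a statement shortens each stack by at most `opDepth` symbols. [folklore] -/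
theorem length_le_length_stepAux (q : TM2.Stmt Γ Λ σ) (v : σ) (S : ∀ k, List (Γ k)) (k : K) :
    (S k).length ≤ ((TM2.stepAux q v S).stk k).length + opDepth q := by
  induction q generalizing v S with
  | push k' f q ih =>
    simp only [TM2.stepAux, opDepth]
    have h1 := ih v (update S k' (f v :: S k'))
    have h2 : (S k).length ≤ (update S k' (f v :: S k') k).length := by
      rcases eq_or_ne k k' with rfl | h
      · simp
      · rw [update_of_ne h]
    omega
  | peek k' f q ih =>
    simp only [TM2.stepAux, opDepth]
    have h1 := ih (f v (S k').head?) S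
    omega
  | pop k' f q ih =>
    simp only [TM2.stepAux, opDepth]
    have h1 := ih (f v (S k').head?) (update S k' (S k').tail)
    have h2 := length_le_length_update_tail S k' k
    omega
  | load f q ih => simp only [TM2.stepAux, opDepth]; exact ih _ _
  | branch p q₁ q₂ ih₁ ih₂ =>
    simp only [TM2.stepAux, opDepth]
    cases p v
    · have h1 := ih₂ v S
      have := le_max_right (opDepth q₁) (opDepth q₂)
      simp only [Bool.cond_false]
      omega
    · have h1 := ih₁ v S
      have := le_max_left (opDepth q₁) (opDepth q₂)
      simp only [Bool.cond_true]
      omega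
  | goto l => simp [TM2.stepAux, opDepth]
  | halt => simp [TM2.stepAux, opDepth]

/-! ### Symbols pushed by a statement -/

/-- `PushesSym q k γ`: the statement `q` contains an instruction `push k f _` with `γ` in the
range of `f` (so `γ` may be written on stack `k` by executing `q`). An inductive family, to
avoid transporting symbols between the fibres `Γ k`. [folklore] -/
inductive PushesSym : TM2.Stmt Γ Λ σ → ∀ k, Γ k → Prop
  | push_here {k : K} (f : σ → Γ k) (q : TM2.Stmt Γ Λ σ) (v : σ) :
      PushesSym (TM2.Stmt.push k f q) k (f v)
  | push_below {k k' : K} (f : σ → Γ k') (q : TM2.Stmt Γ Λ σ) {γ : Γ k}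
      (h : PushesSym q k γ) : PushesSym (TM2.Stmt.push k' f q) k γ
  | peek {k k' : K} (f : σ → Option (Γ k') → σ) (q : TM2.Stmt Γ Λ σ) {γ : Γ k}
      (h : PushesSym q k γ) : PushesSym (TM2.Stmt.peek k' f q) k γ
  | pop {k k' : K} (f : σ → Option (Γ k') → σ) (q : TM2.Stmt Γ Λ σ) {γ : Γ k}
      (h : PushesSym q k γ) : PushesSym (TM2.Stmt.pop k' f q) k γ
  | load {k : K} (f : σ → σ) (q : TM2.Stmt Γ Λ σ) {γ : Γ k} (h : PushesSym q k γ) :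
      PushesSym (TM2.Stmt.load f q) k γ
  | branch_left {k : K} (p : σ → Bool) (q₁ q₂ : TM2.Stmt Γ Λ σ) {γ : Γ k}
      (h : PushesSym q₁ k γ) : PushesSym (TM2.Stmt.branch p q₁ q₂) k γ
  | branch_right {k : K} (p : σ → Bool) (q₁ q₂ : TM2.Stmt Γ Λ σ) {γ : Γ k}
      (h : PushesSym q₂ k γ) : PushesSym (TM2.Stmt.branch p q₁ q₂) k γ

/-- **Symbol invariant for one statement.** If every symbol on the stacks satisfies a
predicate `A` closed under the symbols pushable by `q`, then so does every symbol after
executing `q`. [folklore] -/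
theorem stepAux_stk_mem (A : ∀ k, Γ k → Prop) (q : TM2.Stmt Γ Λ σ)
    (hq : ∀ k γ, PushesSym q k γ → A k γ) (v : σ) (S : ∀ k, List (Γ k))
    (hS : ∀ k, ∀ γ ∈ S k, A k γ) : ∀ k, ∀ γ ∈ (TM2.stepAux q v S).stk k, A k γ := by
  induction q generalizing v S with
  | push k' f q ih =>
    simp only [TM2.stepAux]
    refine ih (fun k γ h => hq k γ (PushesSym.push_below f q h)) _ _ fun k γ hγ => ?_
    rcases eq_or_ne k k' with rfl | hk
    · simp only [update_self, List.mem_cons] at hγ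
      rcases hγ with rfl | hγ
      · exact hq k _ (PushesSym.push_here f q v)
      · exact hS k γ hγ
    · rw [update_of_ne hk] at hγ; exact hS k γ hγ
  | peek k' f q ih =>
    simp only [TM2.stepAux]
    exact ih (fun k γ h => hq k γ (PushesSym.peek f q h)) _ _ hS
  | pop k' f q ih =>
    simp only [TM2.stepAux]
    refine ih (fun k γ h => hq k γ (PushesSym.pop f q h)) _ _ fun k γ hγ => ?_
    rcases eq_or_ne k k' with rfl | hk
    · simp only [update_self] at hγ
      exact hS k γ (List.mem_of_mem_tail hγ)
    · rw [update_of_ne hk] at hγ; exact hS k γ hγ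
  | load f q ih =>
    simp only [TM2.stepAux]
    exact ih (fun k γ h => hq k γ (PushesSym.load f q h)) _ _ hS
  | branch p q₁ q₂ ih₁ ih₂ =>
    simp only [TM2.stepAux]
    cases p v
    · exact ih₂ (fun k γ h => hq k γ (PushesSym.branch_right p q₁ q₂ h)) _ _ hS
    · exact ih₁ (fun k γ h => hq k γ (PushesSym.branch_left p q₁ q₂ h)) _ _ hS
  | goto l => simpa [TM2.stepAux] using hS
  | halt => simpa [TM2.stepAux] using hS

/-- The set of symbols pushable on stack `k` by a statement is finite (a finite union of
ranges of maps out of the finite state type). [folklore] -/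
theorem finite_pushesSym [Finite σ] (q : TM2.Stmt Γ Λ σ) (k : K) :
    Set.Finite {γ : Γ k | PushesSym q k γ} := by
  induction q with
  | push k' f q ih =>
    by_cases hk : k' = k
    · subst hk
      apply (Set.finite_union.2 ⟨Set.finite_range f, ih⟩).subset
      intro γ hγ
      simp only [Set.mem_setOf_eq] at hγ
      cases hγ with
      | push_here _ _ v => exact Or.inl ⟨v, rfl⟩
      | push_below _ _ h => exact Or.inr h
    · apply ih.subset
      intro γ hγ
      simp only [Set.mem_setOf_eq] at hγ
      cases hγ with
      | push_here _ _ v => exact absurd rfl hk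
      | push_below _ _ h => exact h
  | peek k' f q ih =>
    apply ih.subset
    intro γ hγ
    simp only [Set.mem_setOf_eq] at hγ
    cases hγ with
    | peek _ _ h => exact h
  | pop k' f q ih =>
    apply ih.subset
    intro γ hγ
    simp only [Set.mem_setOf_eq] at hγ
    cases hγ with
    | pop _ _ h => exact h
  | load f q ih =>
    apply ih.subset
    intro γ hγ
    simp only [Set.mem_setOf_eq] at hγ
    cases hγ with
    | load _ _ h => exact h
  | branch p q₁ q₂ ih₁ ih₂ =>
    apply (Set.finite_union.2 ⟨ih₁, ih₂⟩).subset
    intro γ hγ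
    simp only [Set.mem_setOf_eq] at hγ
    cases hγ with
    | branch_left _ _ _ h => exact Or.inl h
    | branch_right _ _ _ h => exact Or.inr h
  | goto l =>
    apply Set.finite_empty.subset
    intro γ hγ
    simp only [Set.mem_setOf_eq] at hγ
    cases hγ
  | halt =>
    apply Set.finite_empty.subset
    intro γ hγ
    simp only [Set.mem_setOf_eq] at hγ
    cases hγ

end Stmt

/-! ### Machine level: the total step function, halting runs, windows -/

section Machine

variable (tm : FinTM2)

/-- The window size of a machine: the maximal stack-operation depth of its statements.
[folklore] -/
noncomputable def depth : ℕ :=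
  letI := tm.ΛFin
  Finset.univ.sup fun l => opDepth (tm.m l)

/-- Every statement of the machine has operation depth at most `depth`. [folklore] -/
theorem opDepth_le_depth (l : tm.Λ) : opDepth (tm.m l) ≤ depth tm := by
  letI := tm.ΛFin
  exact Finset.le_sup (f := fun l => opDepth (tm.m l)) (Finset.mem_univ l)

/-- The **total step function**: one step of the machine, and the identity on halted
configurations (label `none`). Iterating it `T` times from the initial configuration of a
computation halting within `T` steps yields the halting configuration
(`iterate_stepTotal_of_outputsWithin`). (Sipser 2012, proof of Thm. 9.30: the tableau has
exactly `t(n)` rows, a machine that has halted keeps its configuration.)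
[cite: Sipser2012, Thm. 9.30 (proof)] -/
def stepTotal (c : tm.Cfg) : tm.Cfg :=
  match c.l with
  | none => c
  | some l => TM2.stepAux (tm.m l) c.var c.stk

/-- A halted configuration is fixed by `stepTotal`. [folklore] -/
theorem stepTotal_of_none {c : tm.Cfg} (h : c.l = none) : stepTotal tm c = c := by
  unfold stepTotal; rw [h]

/-- On a running configuration `stepTotal` executes the current statement. [folklore] -/
theorem stepTotal_of_some {c : tm.Cfg} {l : tm.Λ} (h : c.l = some l) :
    stepTotal tm c = TM2.stepAux (tm.m l) c.var c.stk := by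
  unfold stepTotal; rw [h]

/-- Mathlib's partial step is `some ∘ stepTotal` on running configurations. [folklore] -/
theorem step_eq_of_some {c : tm.Cfg} {l : tm.Λ} (h : c.l = some l) :
    tm.step c = some (stepTotal tm c) := by
  obtain ⟨l', v, S⟩ := c
  cases h
  rfl

/-- Mathlib's partial step is undefined on halted configurations. [folklore] -/
theorem step_eq_of_none {c : tm.Cfg} (h : c.l = none) : tm.step c = none := by
  obtain ⟨l', v, S⟩ := c
  cases h
  rfl

/-- A defined `n`-step run of the partial step function is an `n`-fold iterate of the total
step function. [folklore] -/
theorem iterate_stepTotal_of_bind {n : ℕ} :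
    ∀ {a b : tm.Cfg}, (flip bind tm.step)^[n] (some a) = some b → (stepTotal tm)^[n] a = b := by
  induction n with
  | zero => intro a b h; simpa using h
  | succ n ih =>
    intro a b h
    rw [TM2Comp.iterate_bind_succ] at h
    cases hl : a.l with
    | none => rw [step_eq_of_none tm hl, TM2Comp.iterate_bind_none] at h; cases h
    | some l =>
      rw [step_eq_of_some tm hl] at h
      rw [iterate_succ_apply]
      exact ih h

/-- A halted configuration is fixed by every iterate of `stepTotal`. [folklore] -/
theorem iterate_stepTotal_of_none {c : tm.Cfg} (h : c.l = none) (n : ℕ) :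
    (stepTotal tm)^[n] c = c := by
  induction n with
  | zero => rfl
  | succ n ih => rw [iterate_succ_apply, stepTotal_of_none tm h, ih]

/-- The halting configuration has no label. [folklore] -/
theorem haltList_l (s : List (tm.Γ tm.k₁)) : (haltList tm s).l = none := rfl

/-- **Halting runs as exact iterates.** If `M` maps `l` to `l'` within `T` steps, then `T`
iterations of the total step function take the initial configuration to the halting
configuration. [cite: Sipser2012, Thm. 9.30 (proof)] -/
theorem iterate_stepTotal_of_outputsWithin {Γ₀ Γ₁ : Type} (M : TM2ComputableAux Γ₀ Γ₁)
    {l : List Γ₀} {l' : List Γ₁} {T : ℕ} (h : M.OutputsWithin l l' T) :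
    (stepTotal M.tm)^[T] (initList M.tm (l.map M.inputAlphabet.symm)) =
      haltList M.tm (l'.map M.outputAlphabet.symm) := by
  obtain ⟨⟨⟨n, hn⟩, hnT⟩⟩ := h
  change n ≤ T at hnT
  have h1 := iterate_stepTotal_of_bind M.tm hn
  obtain ⟨d, rfl⟩ := Nat.exists_eq_add_of_le hnT
  rw [add_comm, iterate_add_apply, h1, iterate_stepTotal_of_none _ (haltList_l _ _)]

/-- **Window form of a machine step.** With `d ≥ depth tm`, one (total) step of the machine
on a configuration equals the step on the *truncated* configuration whose stacks are the
top-`d` windows, followed by re-appending the parts of the stacks below depth `d`.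
Consequently the new label, state and the new top segments are a function of the label, the
state and the `d` topmost symbols of each stack only. (Sipser 2012, proof of Thm. 9.30;
Arora–Barak 2009, proof of Thm. 6.6; the multi-stack form is folklore.)
[cite: Sipser2012, Thm. 9.30 (proof)] -/
theorem stepTotal_window (c : tm.Cfg) (d : ℕ) (hd : depth tm ≤ d) :
    stepTotal tm c =
      ⟨(stepTotal tm ⟨c.l, c.var, fun k => (c.stk k).take d⟩).l,
        (stepTotal tm ⟨c.l, c.var, fun k => (c.stk k).take d⟩).var,
        fun k => (stepTotal tm ⟨c.l, c.var, fun k => (c.stk k).take d⟩).stk k ++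
          (c.stk k).drop d⟩ := by
  obtain ⟨_ | l, v, S⟩ := c
  · simp [stepTotal]
  · simp only [stepTotal]
    have hS : S = fun k => (S k).take d ++ (S k).drop d := funext fun k => (List.take_append_drop d (S k)).symm
    conv_lhs => rw [hS]
    refine stepAux_append (tm.m l) v (fun k => (S k).take d) (fun k => (S k).drop d) fun k => ?_
    by_cases hk : d ≤ (S k).length
    · left
      rw [List.length_take, min_eq_left hk]
      exact (opDepth_le_depth tm l).trans hd
    · right
      exact List.drop_eq_nil_of_le (by omega)

/-- One total step lengthens each stack by at most `depth` symbols. [folklore] -/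
theorem length_stepTotal_le (c : tm.Cfg) (k : tm.K) :
    ((stepTotal tm c).stk k).length ≤ (c.stk k).length + depth tm := by
  cases hl : c.l with
  | none => rw [stepTotal_of_none tm hl]; omega
  | some l =>
    rw [stepTotal_of_some tm hl]
    exact (length_stepAux_le' _ _ _ _).trans (Nat.add_le_add_left (opDepth_le_depth tm l) _)

/-- The truncated configuration: same label and state, stacks cut to their top-`d` windows.
[folklore] -/
def truncate (d : ℕ) (c : tm.Cfg) : tm.Cfg :=
  ⟨c.l, c.var, fun k => (c.stk k).take d⟩

/-- **Cell form of a machine step** (top of stack = cell `0`). With `d ≥ depth tm` and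
`W'` the new window of stack `k` computed on the truncated configuration, cell `j` of stack
`k` after the step is cell `j` of `W'` if `j < |W'|`, and otherwise the old cell
`j - |W'| + d`: below the window the stack is shifted by `d - |W'| ∈ [-d, d]`.
(Sipser 2012, proof of Thm. 9.30, in `TM2` form.) [cite: Sipser2012, Thm. 9.30 (proof)] -/
theorem getElem?_stepTotal_stk (c : tm.Cfg) (d : ℕ) (hd : depth tm ≤ d) (k : tm.K) (j : ℕ) :
    ((stepTotal tm c).stk k)[j]? =
      if j < ((stepTotal tm (truncate tm d c)).stk k).length then
        ((stepTotal tm (truncate tm d c)).stk k)[j]?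
      else (c.stk k)[j - ((stepTotal tm (truncate tm d c)).stk k).length + d]? := by
  rw [stepTotal_window tm c d hd]
  simp only [truncate]
  split_ifs with hj
  · exact List.getElem?_append_left hj
  · rw [List.getElem?_append_right (by omega), List.getElem?_drop]
    congr 1
    omega

/-- The new window has length at most `2d`. [folklore] -/
theorem length_stepTotal_truncate_le (c : tm.Cfg) (d : ℕ) (hd : depth tm ≤ d) (k : tm.K) :
    ((stepTotal tm (truncate tm d c)).stk k).length ≤ 2 * d := by
  have h1 : ((truncate tm d c).stk k).length ≤ d := by
    simp only [truncate, List.length_take]; exact min_le_left _ _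
  have h2 := length_stepTotal_le tm (truncate tm d c) k
  omega

/-- One total step shortens each stack by at most `depth` symbols. [folklore] -/
theorem length_le_length_stepTotal (c : tm.Cfg) (k : tm.K) :
    (c.stk k).length ≤ ((stepTotal tm c).stk k).length + depth tm := by
  cases hl : c.l with
  | none => rw [stepTotal_of_none tm hl]; omega
  | some l =>
    rw [stepTotal_of_some tm hl]
    exact (length_le_length_stepAux _ _ _ _).trans (Nat.add_le_add_left (opDepth_le_depth tm l) _)

/-- `t` total steps lengthen each stack by at most `depth * t` symbols. [folklore] -/
theorem length_iterate_stepTotal_le (c : tm.Cfg) (k : tm.K) (t : ℕ) :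
    (((stepTotal tm)^[t] c).stk k).length ≤ (c.stk k).length + depth tm * t := by
  induction t with
  | zero => simp
  | succ t ih =>
    rw [iterate_succ_apply']
    have := length_stepTotal_le tm ((stepTotal tm)^[t] c) k
    rw [Nat.mul_succ]
    omega

/-! ### The effective (finite) stack alphabets -/

/-- `IsSym tm k γ`: the symbol `γ` can occur on stack `k` during a computation of `tm` started
on an input word: it is pushable by some statement, or `k` is the input stack (whose alphabet
is finite by `FinTM2.Γk₀Fin`). Note that `FinTM2` does not require the other stack alphabets to
be finite; `IsSym` carves out finite effective alphabets (`finite_isSym`). [folklore] -/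
def IsSym (k : tm.K) (γ : tm.Γ k) : Prop :=
  (∃ l, PushesSym (tm.m l) k γ) ∨ k = tm.k₀

/-- The effective alphabet of every stack is finite. [folklore] -/
theorem finite_isSym (k : tm.K) : Set.Finite {γ : tm.Γ k | IsSym tm k γ} := by
  letI := tm.ΛFin; letI := tm.σFin
  by_cases hk : k = tm.k₀
  · subst hk
    letI := tm.Γk₀Fin
    exact Set.toFinite _
  · have : {γ : tm.Γ k | IsSym tm k γ} = ⋃ l, {γ | PushesSym (tm.m l) k γ} := by
      ext γ; simp [IsSym, hk]
    rw [this]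
    exact Set.finite_iUnion fun l => finite_pushesSym (tm.m l) k

/-- A configuration is *good* if all its stack symbols lie in the effective alphabets.
[folklore] -/
def Good (c : tm.Cfg) : Prop :=
  ∀ k, ∀ γ ∈ c.stk k, IsSym tm k γ

/-- Initial configurations are good (only the input stack is nonempty). [folklore] -/
theorem good_initList (s : List (tm.Γ tm.k₀)) : Good tm (initList tm s) := by
  intro k γ hγ
  rw [TM2Comp.initList_eq] at hγ
  dsimp only at hγ
  by_cases hk : k = tm.k₀
  · exact Or.inr hk
  · rw [update_of_ne hk] at hγ; simp at hγ

/-- Goodness is preserved by a step. [folklore] -/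
theorem Good.stepTotal {c : tm.Cfg} (h : Good tm c) : Good tm (stepTotal tm c) := by
  cases hl : c.l with
  | none => rw [stepTotal_of_none tm hl]; exact h
  | some l =>
    rw [stepTotal_of_some tm hl]
    exact stepAux_stk_mem (IsSym tm) (tm.m l) (fun k γ hp => Or.inl ⟨l, hp⟩) _ _ h

/-- Goodness is preserved along a run. [folklore] -/
theorem Good.iterate {c : tm.Cfg} (h : Good tm c) (t : ℕ) :
    Good tm ((TM2Sim.stepTotal tm)^[t] c) := by
  induction t with
  | zero => exact h
  | succ t ih => rw [iterate_succ_apply']; exact ih.stepTotal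

end Machine

end Literature.Computability.Complexity.TM2Sim
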